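/-
Copyright (c) 2026 the pub-hodgecm-mathlib formalisation cell (harness21).  Prover seat hodgecm-mathlib-F0P3a-p05 (g18): road «S3-ram» (LEAD F0P3a-plan (g13);
owner F0P3a-p06), (Cnt2′) route B (chair F0P3a-p07 (g15) RULING (16)(b) «REGIME A-EVEN HYPERBOLIC», W-side), the CLASS-KEYED root-region transport; 2026-09-02.
-/
import Literature.NumberTheory.Automorphic.UnitaryLatticeTreeBlockRootRegionAxisTop   -- ★ p849253 (F0P3a-p01 (g18)): `single_one_one_mem_of_selfDual_lev_of_top`, THM 3 template; brings ★ (z1-d∕e) `ncard_selfDual_fixed_axis_eq`, ★ `exists_class_latt_endoGL_one_iff`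
import HarnessLib

/-!
# The lattice graph of a hermitian space — the root region of the HYPERBOLIC block literal at the TOP level, KEYED BY THE VERTEX CLASS TOKEN, counted on the `W`-side
# (Bruhat–Tits 1972 §10; Kottwitz 1986 §3; Labesse–Langlands 1979 §2)

Topic `NumberTheory/Automorphic`; namespace `Literature.NumberTheory.Automorphic.UnitaryLatticeTree`.  THEOREMS ONLY (no definition, no instance, no notation, no named fact,
no `sorry`); kernel lane `--supports stmt-HodgeConjecture-24833`; datum-free (`K` with `Valued K ℤᵐ⁰`, `σ` any valuation-preserving involution, `|2| = 1`).  Cell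
`pub/hodgecm-mathlib` (D-0151), crux H413; road «S3-ram» (count-neutral); (Cnt2′) route B, chair RULING (16)(b): in regime **A-even** of the hyperbolic literal `γ = ι(γ₂, u)`
(`N = 2n`, root level `d₀ = N − 1`, `|½tr γ₂ − u₀₀| ≤ |ϖ|^(d₀+1)`, top `W`-ball empty) the root region `R = {v ∣ γ·v = v ∧ SD v.1 ∧ (γ − 1)·v.1 ≤ ϖ^d₀·v.1}` of the junction
heads (★ `strataCount_J₀_of_charpoly_block_raw` ∕ `…_block_even`) consists of `q + 1` AXIS vertices (F0P3a-p01 (g18) ★ `single_one_one_mem_of_selfDual_lev_of_top`,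
`ncard_rootRegion_eq_ncard_two_of_top`), and the per-vertex grandchild census (A-p12 (g25) ★ (K1)∕(K2)) is constant on the two KINDS cut out by the vertex's own class token
`CLS_(d₀)(c₀)(v) :⟺ ∃ y ∈ v.1, a ∈ 𝒪^×, |(ϖ^d₀)⁻¹⟨y, (γ − 1)y⟩ − c₀a²| < 1` (its residual rank-one value).  This file transports the two KIND COUNTS to the `W`-side, where this
seat's ★ `two_mul_ncard_selfDual_fixed_lev_class_eq_of_top_of_even_depth_ramified` ∕ `…_not_class_…` (`Rogawski1990/…WSideLatticeCurrencyTopKinds`) give `2·# = q + 1` each: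

* **`ncard_rootRegion_class_eq_ncard_two_of_top`** — `#{v ∣ v ∈ R ∧ CLS_(d₀)(c₀)(v)} = #{B ∣ SD_{Φ₂} B ∧ γ₂B = B ∧ ((γ₂ − 1)B ≤ ϖ^d₀ B ∧ CLS^W_(d₀)(c₀)(B))}`;
* **`ncard_rootRegion_not_class_eq_ncard_two_of_top`** — the same with `¬CLS_(d₀)(c₀)` on both sides.
Mechanism = ★ THM 3 verbatim with a richer label: the vertex set is the `Subtype.val`-copy of the rank-3 lattice set, every member contains `e₁` (★ THM 1), and ★ (z1-d)
`ncard_selfDual_fixed_axis_eq` moves the label `LEV ∧ [¬]CLS` to the `W`-block through ★ `map_endoGL_sub_one_latt_endoGL_le_scaleLattice_iff` (`|u₀₀ − 1| ≤ |ϖ^d₀|`) and ★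
`exists_class_latt_endoGL_one_iff` (`|(ϖ^d₀)⁻¹(u₀₀ − 1)| < 1`, whence the hypothesis `|u₀₀ − 1| ≤ |ϖ^(d₀+1)|`; for the centred literal `u = 1` both are `by simp`).  The token
texts are the raw head's, with `(StdForm.antidiagonal 3).over K` in the pairing (rewritten to the `ι`-shape by ★ `antidiagonal_three_over_eq_endoShape` inside the proof only).
HONEST LABEL: HC_CM is proved only modulo the 2 remaining named inputs (hLiu418 24832, h413 24833) until rung 0 closes; nothing printed is asserted here (elementary lattice
bookkeeping over ★ results); «S3-ram» has no books consequence.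

## References
* [BruhatTits1972] F. Bruhat, J. Tits, *Groupes réductifs sur un corps local I*, Publ. Math. IHÉS 41 (1972), §10 (lattice models of the building; the axis of a Levi block).
* [Kottwitz1986] R. E. Kottwitz, *Base change for unit elements of Hecke algebras*, Compositio Math. 60 (1986), §3 (fixed lattices of a block element, counted along the axis).
* [LabesseLanglands1979] J.-P. Labesse, R. P. Langlands, *L-indistinguishability for SL(2)*, Canad. J. Math. 31 (1979), §2 Lemma 2.1 p. 8.
* [Rogawski1990] J. D. Rogawski, *Automorphic Representations of Unitary Groups in Three Variables*, Ann. of Math. Stud. 123 (1990), §4.8 Case (a) p. 53, §4.9 pp. 54–56.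
-/

set_option autoImplicit false

noncomputable section

open scoped Valued WithZero Matrix MatrixGroups

namespace Literature.NumberTheory.Automorphic.UnitaryLatticeTree

open Literature.NumberTheory.Automorphic Literature.NumberTheory.Automorphic.HermitianLattice Literature.NumberTheory.Rogawski1990

variable {K : Type*} [Field K] [Valued K ℤᵐ⁰]

/-! ## The class-keyed root region at the top level, counted on the `W`-side -/

set_option maxHeartbeats 1600000 in -- budget only: statement-heavy lattice tokens.
/-- **THE ROOT REGION KEYED BY THE CLASS TOKEN, CLASS PRESENT (A-even, top level).**  For `γ ∈ U(σ, Φ₃)` with matrix `ι(γ₂, u)`, `γ₂ ∈ U(σ, Φ₂)` (`Φ₂ = !![0,1;1,0]`), `|u₀₀| = 1`,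
`|u₀₀ − 1| ≤ |ϖ^(d₀+1)|`, `|½tr γ₂ − u₀₀| ≤ |ϖ^(d₀+1)|`, TOP-ness at `d₀` (no `γ₂`-fixed self-dual `B` with `(γ₂ − ½tr γ₂·1)B ≤ ϖ^(d₀+1)B`) and any class constant `c₀`:
`#{v ∣ (γ·v = v ∧ SD v.1 ∧ (γ − 1)·v.1 ≤ ϖ^d₀·v.1) ∧ CLS_(d₀)(c₀)(v.1)} = #{B ∣ SD_{Φ₂} B ∧ γ₂·B = B ∧ ((γ₂ − 1)·B ≤ ϖ^d₀·B ∧ CLS^W_(d₀)(c₀)(B))}` — every region vertex is an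
axis vertex (★ `single_one_one_mem_of_selfDual_lev_of_top`), and on axis vertices both tokens are read on the `W`-block (★ `ncard_selfDual_fixed_axis_eq`,
★ `map_endoGL_sub_one_latt_endoGL_le_scaleLattice_iff`, ★ `exists_class_latt_endoGL_one_iff`).  The kind `CLS_(d₀)(c₀)` is the class of the vertex's own residual rank-one
value (regime A-even: nilpotent traceless `W`-part), on which the grandchild census of ★ (K2) is constant.
[cite: Kottwitz1986, §3] [cite: BruhatTits1972, §10] [cite: LabesseLanglands1979, §2 Lemma 2.1 p. 8] [cite: Rogawski1990, §4.9 pp. 54–56] -/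
theorem ncard_rootRegion_class_eq_ncard_two_of_top [IsPrincipalIdealRing 𝒪[K]] {σ : K →+* K} {ϖ : K}
    (hσ : ∀ a, σ (σ a) = a) (hvσ : ∀ a, Valued.v (σ a) = Valued.v a) (hϖ : Valued.v ϖ = WithZero.exp (-1 : ℤ)) (h2 : Valued.v (2 : K) = 1)
    (γ : unitaryGroupOfForm σ ((StdForm.antidiagonal 3).over K)) (γ₂ : GL (Fin 2) K) (u : GL (Fin 1) K) (hγ : (γ : GL (Fin 3) K) = endoGL (γ₂, u))
    (hγU : γ₂ ∈ unitaryGroupOfForm σ (!![(0 : K), 1; 1, 0] : Matrix (Fin 2) (Fin 2) K))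
    (hu : Valued.v ((u : Matrix (Fin 1) (Fin 1) K) 0 0) = 1) {d₀ : ℕ} (hud : Valued.v ((u : Matrix (Fin 1) (Fin 1) K) 0 0 - 1) ≤ Valued.v (ϖ ^ (d₀ + 1)))
    (hα : Valued.v ((γ₂ : Matrix (Fin 2) (Fin 2) K).trace / 2 - (u : Matrix (Fin 1) (Fin 1) K) 0 0) ≤ Valued.v (ϖ ^ (d₀ + 1)))
    (htop : {B : Submodule 𝒪[K] (Fin 2 → K) | IsSelfDualLattice σ ϖ (!![(0 : K), 1; 1, 0] : Matrix (Fin 2) (Fin 2) K) B ∧ mapGL γ₂ B = B ∧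
        B.map ((Matrix.toLin' ((γ₂ : Matrix (Fin 2) (Fin 2) K) - ((γ₂ : Matrix (Fin 2) (Fin 2) K).trace / 2) • (1 : Matrix (Fin 2) (Fin 2) K))).restrictScalars 𝒪[K]) ≤
          scaleLattice (ϖ ^ (d₀ + 1)) B} = ∅) (c₀ : K) :
    {v : {M : Submodule 𝒪[K] (Fin 3 → K) // IsVertex σ ϖ ((StdForm.antidiagonal 3).over K) M} | v ∈ {v : {M : Submodule 𝒪[K] (Fin 3 → K) // IsVertex σ ϖ ((StdForm.antidiagonal 3).over K) M} | latticeGraphIso σ ϖ ((StdForm.antidiagonal 3).over K) γ v = v ∧ IsSelfDualLattice σ ϖ ((StdForm.antidiagonal 3).over K) v.1 ∧ v.1.map ((Matrix.toLin' (((γ : GL (Fin 3) K) : Matrix (Fin 3) (Fin 3) K) - 1)).restrictScalars 𝒪[K]) ≤ scaleLattice (ϖ ^ d₀) v.1} ∧ ∃ y ∈ v.1, ∃ a : K, Valued.v a = 1 ∧ Valued.v ((ϖ ^ d₀)⁻¹ * pairing σ ((StdForm.antidiagonal 3).over K) y ((((γ : GL (Fin 3) K) : Matrix (Fin 3) (Fin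 3) K) - 1) *ᵥ y) - c₀ * a ^ 2) < 1}.ncard =
    {B : Submodule 𝒪[K] (Fin 2 → K) | IsSelfDualLattice σ ϖ (!![(0 : K), 1; 1, 0] : Matrix (Fin 2) (Fin 2) K) B ∧ mapGL γ₂ B = B ∧ (B.map ((Matrix.toLin' ((γ₂ : Matrix (Fin 2) (Fin 2) K) - 1)).restrictScalars 𝒪[K]) ≤ scaleLattice (ϖ ^ d₀) B ∧ ∃ y₂ ∈ B, ∃ a : K, Valued.v a = 1 ∧ Valued.v ((ϖ ^ d₀)⁻¹ * pairing σ (!![(0 : K), 1; 1, 0] : Matrix (Fin 2) (Fin 2) K) y₂ (((γ₂ : Matrix (Fin 2) (Fin 2) K) - 1) *ᵥ y₂) - c₀ * a ^ 2) < 1)}.ncard := by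
  have hϖ0' : Valued.v ϖ ≠ 0 := by rw [hϖ]; exact WithZero.exp_ne_zero
  have hϖ0 : ϖ ≠ 0 := fun h0 => by rw [h0, map_zero] at hϖ0'; exact hϖ0' rfl
  have hϖ1 : Valued.v ϖ ≤ 1 := by rw [hϖ, ← WithZero.exp_zero]; exact WithZero.exp_le_exp.2 (by norm_num)
  have hϖlt : Valued.v ϖ < 1 := by rw [hϖ, ← WithZero.exp_zero]; exact WithZero.exp_lt_exp.2 (by norm_num)
  have hH₂ : IsUnit (!![(0 : K), 1; 1, 0] : Matrix (Fin 2) (Fin 2) K).det := by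
    rw [Matrix.det_fin_two]; simp
  -- `|u₀₀ − 1| ≤ |ϖ^(d₀+1)| ≤ |ϖ^d₀|` and `|(ϖ^d₀)⁻¹(u₀₀ − 1)| ≤ |ϖ| < 1`
  have hud' : Valued.v ((u : Matrix (Fin 1) (Fin 1) K) 0 0 - 1) ≤ Valued.v (ϖ ^ d₀) := by
    refine hud.trans ?_
    rw [map_pow, map_pow]
    exact pow_le_pow_right_of_le_one' hϖ1 (Nat.le_succ d₀)
  have hne : Valued.v (ϖ ^ d₀) ≠ 0 := (Valuation.ne_zero_iff _).2 (pow_ne_zero _ hϖ0)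
  have huc : Valued.v ((ϖ ^ d₀)⁻¹ * ((u : Matrix (Fin 1) (Fin 1) K) 0 0 - 1)) < 1 := by
    rw [map_mul, map_inv₀]
    refine lt_of_le_of_lt ?_ hϖlt
    calc (Valued.v (ϖ ^ d₀))⁻¹ * Valued.v ((u : Matrix (Fin 1) (Fin 1) K) 0 0 - 1)
        ≤ (Valued.v (ϖ ^ d₀))⁻¹ * Valued.v (ϖ ^ (d₀ + 1)) := mul_le_mul' le_rfl hud
      _ = Valued.v ϖ := by rw [pow_succ, map_mul, ← mul_assoc, inv_mul_cancel₀ hne, one_mul]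
  -- the vertex set is the copy of the rank-3 lattice set under `v ↦ v.1`, and every member is an axis vertex (★ THM 1)
  have himg : (Subtype.val '' {v : {M : Submodule 𝒪[K] (Fin 3 → K) // IsVertex σ ϖ ((StdForm.antidiagonal 3).over K) M} | v ∈ {v : {M : Submodule 𝒪[K] (Fin 3 → K) // IsVertex σ ϖ ((StdForm.antidiagonal 3).over K) M} | latticeGraphIso σ ϖ ((StdForm.antidiagonal 3).over K) γ v = v ∧ IsSelfDualLattice σ ϖ ((StdForm.antidiagonal 3).over K) v.1 ∧ v.1.map ((Matrix.toLin' (((γ : GL (Fin 3) K) : Matrix (Fin 3) (Fin 3) K) - 1)).restrictScalars 𝒪[K]) ≤ scaleLattice (ϖ ^ d₀) v.1} ∧ ∃ y ∈ v.1, ∃ a : K, Valued.v a = 1 ∧ Valued.v ((ϖ ^ d₀)⁻¹ * pairing σ ((StdForm.antidiagonal 3).over K) y ((((γ : GL (Fin 3) K) : Matrix (Fin 3) (Fin 3) K) - 1) *ᵥ y) - c₀ * a ^ 2) < 1}) =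
      {M : Submodule 𝒪[K] (Fin 3 → K) | IsSelfDualLattice σ ϖ (!![((!![(0 : K), 1; 1, 0] : Matrix (Fin 2) (Fin 2) K)) 0 0, 0, ((!![(0 : K), 1; 1, 0] : Matrix (Fin 2) (Fin 2) K)) 0 1; 0, (1 : K), 0; ((!![(0 : K), 1; 1, 0] : Matrix (Fin 2) (Fin 2) K)) 1 0, 0, ((!![(0 : K), 1; 1, 0] : Matrix (Fin 2) (Fin 2) K)) 1 1] : Matrix (Fin 3) (Fin 3) K) M ∧
        mapGL (endoGL (γ₂, u)) M = M ∧ (Pi.single 1 1 : Fin 3 → K) ∈ M ∧ (M.map ((Matrix.toLin' (((endoGL (γ₂, u) : GL (Fin 3) K) : Matrix (Fin 3) (Fin 3) K) - 1)).restrictScalars 𝒪[K]) ≤ scaleLattice (ϖ ^ d₀) M ∧ (∃ y ∈ M, ∃ a : K, Valued.v a = 1 ∧ Valued.v ((ϖ ^ d₀)⁻¹ * pairing σ ((StdForm.antidiagonal 3).over K) y ((((endoGL (γ₂, u) : GL (Fin 3) K) : Matrix (Fin 3) (Fin 3) K) - 1) *ᵥ y) - c₀ * a ^ 2) < 1))}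 := by
    ext M
    simp only [Set.mem_image, Set.mem_setOf_eq]
    constructor
    · rintro ⟨v, ⟨⟨hfix, hSD, hlev⟩, hcls⟩, rfl⟩
      have e := congrArg Subtype.val hfix
      rw [latticeGraphIso_apply_coe, hγ] at e
      have hSD' : IsSelfDualLattice σ ϖ (!![((!![(0 : K), 1; 1, 0] : Matrix (Fin 2) (Fin 2) K)) 0 0, 0, ((!![(0 : K), 1; 1, 0] : Matrix (Fin 2) (Fin 2) K)) 0 1; 0, (1 : K), 0; ((!![(0 : K), 1; 1, 0] : Matrix (Fin 2) (Fin 2) K)) 1 0, 0, ((!![(0 : K), 1; 1, 0] : Matrix (Fin 2) (Fin 2) K)) 1 1] : Matrix (Fin 3) (Fin 3) K) v.1 := by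
        rw [← antidiagonal_three_over_eq_endoShape]; exact hSD
      rw [hγ] at hlev hcls
      exact ⟨hSD', e, single_one_one_mem_of_selfDual_lev_of_top σ hσ hvσ hϖ h2 γ₂ hγU u hα htop hSD
        (forall_mulVec_mem_scaleLattice_of_map_le _ _ _ hlev), hlev, hcls⟩
    · rintro ⟨hSD, hfix, -, hlev, hcls⟩
      rw [← antidiagonal_three_over_eq_endoShape] at hSD
      refine ⟨⟨M, 0, hSD⟩, ⟨⟨?_, hSD, ?_⟩, ?_⟩, rfl⟩
      · apply Subtype.ext
        rw [latticeGraphIso_apply_coe, hγ]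
        exact hfix
      · rw [hγ]; exact hlev
      · rw [hγ]; exact hcls
  rw [← Set.ncard_image_of_injective _ Subtype.val_injective, himg]
  refine ncard_selfDual_fixed_axis_eq σ hvσ hϖ0 hϖ1 hH₂ (h := (1 : K)) (by rw [map_one]) γ₂ hu
    (fun M => M.map ((Matrix.toLin' (((endoGL (γ₂, u) : GL (Fin 3) K) : Matrix (Fin 3) (Fin 3) K) - 1)).restrictScalars 𝒪[K]) ≤ scaleLattice (ϖ ^ d₀) M ∧ (∃ y ∈ M, ∃ a : K, Valued.v a = 1 ∧ Valued.v ((ϖ ^ d₀)⁻¹ * pairing σ ((StdForm.antidiagonal 3).over K) y ((((endoGL (γ₂, u) : GL (Fin 3) K) : Matrix (Fin 3) (Fin 3) K) - 1) *ᵥ y) - c₀ * a ^ 2) < 1))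
    (fun B => B.map ((Matrix.toLin' ((γ₂ : Matrix (Fin 2) (Fin 2) K) - 1)).restrictScalars 𝒪[K]) ≤ scaleLattice (ϖ ^ d₀) B ∧ (∃ y₂ ∈ B, ∃ a : K, Valued.v a = 1 ∧ Valued.v ((ϖ ^ d₀)⁻¹ * pairing σ (!![(0 : K), 1; 1, 0] : Matrix (Fin 2) (Fin 2) K) y₂ (((γ₂ : Matrix (Fin 2) (Fin 2) K) - 1) *ᵥ y₂) - c₀ * a ^ 2) < 1)) fun g₂ => ?_
  -- the label at an axis frame `latt ι(g₂, 1)`: level token and class token move to the `W`-block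
  simp only [antidiagonal_three_over_eq_endoShape]
  rw [map_endoGL_sub_one_latt_endoGL_le_scaleLattice_iff (pow_ne_zero d₀ hϖ0),
    exists_class_latt_endoGL_one_iff σ hvσ (!![(0 : K), 1; 1, 0] : Matrix (Fin 2) (Fin 2) K) (h := (1 : K)) (by rw [map_one]) g₂ γ₂ u huc c₀]
  exact ⟨fun H => ⟨H.1.1, H.2⟩, fun H => ⟨⟨H.1, hud'⟩, H.2⟩⟩

set_option maxHeartbeats 1600000 in -- budget only: statement-heavy lattice tokens.
/-- **THE ROOT REGION KEYED BY THE CLASS TOKEN, CLASS ABSENT (A-even, top level)** — the twin of `ncard_rootRegion_class_eq_ncard_two_of_top` with `¬CLS_(d₀)(c₀)` on both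
sides (same mechanism; the two kinds partition the `q + 1` region vertices, and the `W`-side halves are this seat's ★ `…WSideLatticeCurrencyTopKinds`).
[cite: Kottwitz1986, §3] [cite: BruhatTits1972, §10] [cite: LabesseLanglands1979, §2 Lemma 2.1 p. 8] [cite: Rogawski1990, §4.9 pp. 54–56] -/
theorem ncard_rootRegion_not_class_eq_ncard_two_of_top [IsPrincipalIdealRing 𝒪[K]] {σ : K →+* K} {ϖ : K}
    (hσ : ∀ a, σ (σ a) = a) (hvσ : ∀ a, Valued.v (σ a) = Valued.v a) (hϖ : Valued.v ϖ = WithZero.exp (-1 : ℤ)) (h2 : Valued.v (2 : K) = 1)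
    (γ : unitaryGroupOfForm σ ((StdForm.antidiagonal 3).over K)) (γ₂ : GL (Fin 2) K) (u : GL (Fin 1) K) (hγ : (γ : GL (Fin 3) K) = endoGL (γ₂, u))
    (hγU : γ₂ ∈ unitaryGroupOfForm σ (!![(0 : K), 1; 1, 0] : Matrix (Fin 2) (Fin 2) K))
    (hu : Valued.v ((u : Matrix (Fin 1) (Fin 1) K) 0 0) = 1) {d₀ : ℕ} (hud : Valued.v ((u : Matrix (Fin 1) (Fin 1) K) 0 0 - 1) ≤ Valued.v (ϖ ^ (d₀ + 1)))
    (hα : Valued.v ((γ₂ : Matrix (Fin 2) (Fin 2) K).trace / 2 - (u : Matrix (Fin 1) (Fin 1) K) 0 0) ≤ Valued.v (ϖ ^ (d₀ + 1)))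
    (htop : {B : Submodule 𝒪[K] (Fin 2 → K) | IsSelfDualLattice σ ϖ (!![(0 : K), 1; 1, 0] : Matrix (Fin 2) (Fin 2) K) B ∧ mapGL γ₂ B = B ∧
        B.map ((Matrix.toLin' ((γ₂ : Matrix (Fin 2) (Fin 2) K) - ((γ₂ : Matrix (Fin 2) (Fin 2) K).trace / 2) • (1 : Matrix (Fin 2) (Fin 2) K))).restrictScalars 𝒪[K]) ≤
          scaleLattice (ϖ ^ (d₀ + 1)) B} = ∅) (c₀ : K) :
    {v : {M : Submodule 𝒪[K] (Fin 3 → K) // IsVertex σ ϖ ((StdForm.antidiagonal 3).over K) M} | v ∈ {v : {M : Submodule 𝒪[K] (Fin 3 → K) // IsVertex σ ϖ ((StdForm.antidiagonal 3).over K) M} | latticeGraphIso σ ϖ ((StdForm.antidiagonal 3).over K) γ v = v ∧ IsSelfDualLattice σ ϖ ((StdForm.antidiagonal 3).over K) v.1 ∧ v.1.map ((Matrix.toLin' (((γ : GL (Fin 3) K) : Matrix (Fin 3) (Fin 3) K) - 1)).restrictScalars 𝒪[K]) ≤ scaleLattice (ϖ ^ d₀) v.1} ∧ ¬ (∃ y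 ∈ v.1, ∃ a : K, Valued.v a = 1 ∧ Valued.v ((ϖ ^ d₀)⁻¹ * pairing σ ((StdForm.antidiagonal 3).over K) y ((((γ : GL (Fin 3) K) : Matrix (Fin 3) (Fin 3) K) - 1) *ᵥ y) - c₀ * a ^ 2) < 1)}.ncard =
    {B : Submodule 𝒪[K] (Fin 2 → K) | IsSelfDualLattice σ ϖ (!![(0 : K), 1; 1, 0] : Matrix (Fin 2) (Fin 2) K) B ∧ mapGL γ₂ B = B ∧ (B.map ((Matrix.toLin' ((γ₂ : Matrix (Fin 2) (Fin 2) K) - 1)).restrictScalars 𝒪[K]) ≤ scaleLattice (ϖ ^ d₀) B ∧ ¬ (∃ y₂ ∈ B, ∃ a : K, Valued.v a = 1 ∧ Valued.v ((ϖ ^ d₀)⁻¹ * pairing σ (!![(0 : K), 1; 1, 0] : Matrix (Fin 2) (Fin 2) K) y₂ (((γ₂ : Matrix (Fin 2) (Fin 2) K) - 1) *ᵥ y₂) - c₀ * a ^ 2) < 1))}.ncard := by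
  have hϖ0' : Valued.v ϖ ≠ 0 := by rw [hϖ]; exact WithZero.exp_ne_zero
  have hϖ0 : ϖ ≠ 0 := fun h0 => by rw [h0, map_zero] at hϖ0'; exact hϖ0' rfl
  have hϖ1 : Valued.v ϖ ≤ 1 := by rw [hϖ, ← WithZero.exp_zero]; exact WithZero.exp_le_exp.2 (by norm_num)
  have hϖlt : Valued.v ϖ < 1 := by rw [hϖ, ← WithZero.exp_zero]; exact WithZero.exp_lt_exp.2 (by norm_num)
  have hH₂ : IsUnit (!![(0 : K), 1; 1, 0] : Matrix (Fin 2) (Fin 2) K).det := by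
    rw [Matrix.det_fin_two]; simp
  -- `|u₀₀ − 1| ≤ |ϖ^(d₀+1)| ≤ |ϖ^d₀|` and `|(ϖ^d₀)⁻¹(u₀₀ − 1)| ≤ |ϖ| < 1`
  have hud' : Valued.v ((u : Matrix (Fin 1) (Fin 1) K) 0 0 - 1) ≤ Valued.v (ϖ ^ d₀) := by
    refine hud.trans ?_
    rw [map_pow, map_pow]
    exact pow_le_pow_right_of_le_one' hϖ1 (Nat.le_succ d₀)
  have hne : Valued.v (ϖ ^ d₀) ≠ 0 := (Valuation.ne_zero_iff _).2 (pow_ne_zero _ hϖ0)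
  have huc : Valued.v ((ϖ ^ d₀)⁻¹ * ((u : Matrix (Fin 1) (Fin 1) K) 0 0 - 1)) < 1 := by
    rw [map_mul, map_inv₀]
    refine lt_of_le_of_lt ?_ hϖlt
    calc (Valued.v (ϖ ^ d₀))⁻¹ * Valued.v ((u : Matrix (Fin 1) (Fin 1) K) 0 0 - 1)
        ≤ (Valued.v (ϖ ^ d₀))⁻¹ * Valued.v (ϖ ^ (d₀ + 1)) := mul_le_mul' le_rfl hud
      _ = Valued.v ϖ := by rw [pow_succ, map_mul, ← mul_assoc, inv_mul_cancel₀ hne, one_mul]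
  -- the vertex set is the copy of the rank-3 lattice set under `v ↦ v.1`, and every member is an axis vertex (★ THM 1)
  have himg : (Subtype.val '' {v : {M : Submodule 𝒪[K] (Fin 3 → K) // IsVertex σ ϖ ((StdForm.antidiagonal 3).over K) M} | v ∈ {v : {M : Submodule 𝒪[K] (Fin 3 → K) // IsVertex σ ϖ ((StdForm.antidiagonal 3).over K) M} | latticeGraphIso σ ϖ ((StdForm.antidiagonal 3).over K) γ v = v ∧ IsSelfDualLattice σ ϖ ((StdForm.antidiagonal 3).over K) v.1 ∧ v.1.map ((Matrix.toLin' (((γ : GL (Fin 3) K) : Matrix (Fin 3) (Fin 3) K) - 1)).restrictScalars 𝒪[K]) ≤ scaleLattice (ϖ ^ d₀) v.1} ∧ ¬ (∃ y ∈ v.1, ∃ a : K, Valued.v a = 1 ∧ Valued.v ((ϖ ^ d₀)⁻¹ * pairing σ ((StdForm.antidiagonal 3).over K) y ((((γ : GL (Fin 3) K) : Matrix (Fin 3) (Fin 3) K) - 1) *ᵥ y) - c₀ * a ^ 2) < 1)}) =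
      {M : Submodule 𝒪[K] (Fin 3 → K) | IsSelfDualLattice σ ϖ (!![((!![(0 : K), 1; 1, 0] : Matrix (Fin 2) (Fin 2) K)) 0 0, 0, ((!![(0 : K), 1; 1, 0] : Matrix (Fin 2) (Fin 2) K)) 0 1; 0, (1 : K), 0; ((!![(0 : K), 1; 1, 0] : Matrix (Fin 2) (Fin 2) K)) 1 0, 0, ((!![(0 : K), 1; 1, 0] : Matrix (Fin 2) (Fin 2) K)) 1 1] : Matrix (Fin 3) (Fin 3) K) M ∧
        mapGL (endoGL (γ₂, u)) M = M ∧ (Pi.single 1 1 : Fin 3 → K) ∈ M ∧ (M.map ((Matrix.toLin' (((endoGL (γ₂, u) : GL (Fin 3) K) : Matrix (Fin 3) (Fin 3) K) - 1)).restrictScalars 𝒪[K]) ≤ scaleLattice (ϖ ^ d₀) M ∧ ¬ (∃ y ∈ M, ∃ a : K, Valued.v a = 1 ∧ Valued.v ((ϖ ^ d₀)⁻¹ * pairing σ ((StdForm.antidiagonal 3).over K) y ((((endoGL (γ₂, u) : GL (Fin 3) K) : Matrix (Fin 3) (Fin 3) K) - 1) *ᵥ y) - c₀ * a ^ 2) <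 1))} := by
    ext M
    simp only [Set.mem_image, Set.mem_setOf_eq]
    constructor
    · rintro ⟨v, ⟨⟨hfix, hSD, hlev⟩, hcls⟩, rfl⟩
      have e := congrArg Subtype.val hfix
      rw [latticeGraphIso_apply_coe, hγ] at e
      have hSD' : IsSelfDualLattice σ ϖ (!![((!![(0 : K), 1; 1, 0] : Matrix (Fin 2) (Fin 2) K)) 0 0, 0, ((!![(0 : K), 1; 1, 0] : Matrix (Fin 2) (Fin 2) K)) 0 1; 0, (1 : K), 0; ((!![(0 : K), 1; 1, 0] : Matrix (Fin 2) (Fin 2) K)) 1 0, 0, ((!![(0 : K), 1; 1, 0] : Matrix (Fin 2) (Fin 2) K)) 1 1] : Matrix (Fin 3) (Fin 3) K) v.1 := by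
        rw [← antidiagonal_three_over_eq_endoShape]; exact hSD
      rw [hγ] at hlev hcls
      exact ⟨hSD', e, single_one_one_mem_of_selfDual_lev_of_top σ hσ hvσ hϖ h2 γ₂ hγU u hα htop hSD
        (forall_mulVec_mem_scaleLattice_of_map_le _ _ _ hlev), hlev, hcls⟩
    · rintro ⟨hSD, hfix, -, hlev, hcls⟩
      rw [← antidiagonal_three_over_eq_endoShape] at hSD
      refine ⟨⟨M, 0, hSD⟩, ⟨⟨?_, hSD, ?_⟩, ?_⟩, rfl⟩
      · apply Subtype.ext
        rw [latticeGraphIso_apply_coe, hγ]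
        exact hfix
      · rw [hγ]; exact hlev
      · rw [hγ]; exact hcls
  rw [← Set.ncard_image_of_injective _ Subtype.val_injective, himg]
  refine ncard_selfDual_fixed_axis_eq σ hvσ hϖ0 hϖ1 hH₂ (h := (1 : K)) (by rw [map_one]) γ₂ hu
    (fun M => M.map ((Matrix.toLin' (((endoGL (γ₂, u) : GL (Fin 3) K) : Matrix (Fin 3) (Fin 3) K) - 1)).restrictScalars 𝒪[K]) ≤ scaleLattice (ϖ ^ d₀) M ∧ ¬ (∃ y ∈ M, ∃ a : K, Valued.v a = 1 ∧ Valued.v ((ϖ ^ d₀)⁻¹ * pairing σ ((StdForm.antidiagonal 3).over K) y ((((endoGL (γ₂, u) : GL (Fin 3) K) : Matrix (Fin 3) (Fin 3) K) - 1) *ᵥ y) - c₀ * a ^ 2) < 1))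
    (fun B => B.map ((Matrix.toLin' ((γ₂ : Matrix (Fin 2) (Fin 2) K) - 1)).restrictScalars 𝒪[K]) ≤ scaleLattice (ϖ ^ d₀) B ∧ ¬ (∃ y₂ ∈ B, ∃ a : K, Valued.v a = 1 ∧ Valued.v ((ϖ ^ d₀)⁻¹ * pairing σ (!![(0 : K), 1; 1, 0] : Matrix (Fin 2) (Fin 2) K) y₂ (((γ₂ : Matrix (Fin 2) (Fin 2) K) - 1) *ᵥ y₂) - c₀ * a ^ 2) < 1)) fun g₂ => ?_
  -- the label at an axis frame `latt ι(g₂, 1)`: level token and class token move to the `W`-block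
  simp only [antidiagonal_three_over_eq_endoShape]
  rw [map_endoGL_sub_one_latt_endoGL_le_scaleLattice_iff (pow_ne_zero d₀ hϖ0),
    exists_class_latt_endoGL_one_iff σ hvσ (!![(0 : K), 1; 1, 0] : Matrix (Fin 2) (Fin 2) K) (h := (1 : K)) (by rw [map_one]) g₂ γ₂ u huc c₀]
  exact ⟨fun H => ⟨H.1.1, H.2⟩, fun H => ⟨⟨H.1, hud'⟩, H.2⟩⟩

end Literature.NumberTheory.Automorphic.UnitaryLatticeTree

end
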